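import Summits.Langlands.Langlands.Theorems.AdjointSeedFromDuality.Negative.AdjointSeedFromDualityLoadBearing

/-!
# `AdjointSeedFromDuality` (crux stmt-Langlands-16780, route `RamifiedCoefficientSeed`):
# the conclusion forces the parity hypothesis H3 VERBATIM for odd `p`
# (negative-side support, refuter cdisprove seat; does NOT refute the crux)

Sharpening of `forces_parity` (companion file `AdjointSeedFromDualityLoadBearing`): the conclusion of
the crux (`∃` odd `ρ₀`, `η` with the adjoint trace congruence) implies, for `p ≠ 2`, that EVERY
complex conjugation `c` has `tr ρ(c) = 1 ∨ tr ρ(c) = −1` exactly as H3 is typed (equality in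
characteristic `0`), not only modulo `𝔪`: `ρ(c)` is an involution in `GL₃(ℚ̄_p)`, so its trace is
`2r − 3` with `r = rank ½(1 + ρ(c)) ≤ 3` (`trace_involution_fin_three`), and `r ∈ {0, 3}` would give
`‖tr ρ(c) ∓ 1‖ ∈ {‖2‖, ‖4‖} = {1}`, contradicting `forces_parity`.  Moral for provers and planners:
the typed H3 carries no hidden characteristic-zero strength beyond its residual meaning.
-/

noncomputable section

-- `Summit.Langlands.Langlands.…` repeats a namespace component by design (D-0017 nested layout).
set_option linter.dupNamespace false

namespace Summit.Langlands.Langlands.Theorems.AdjointSeedFromDuality.Negative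

open scoped MatrixGroups
open Summit.Langlands.Langlands.Theses.RamifiedCoefficientSeed
open Literature.NumberTheory.GaloisRepresentations

/-- **The trace of an involution in `M₃(F)`, `char F = 0`, is `2r − 3` for some `r ≤ 3`**:
`P = ½(1 + M)` is idempotent and `tr P = rank P` (Mathlib `LinearMap.IsProj.trace`). [folklore] -/
theorem trace_involution_fin_three {F : Type*} [Field F] [CharZero F]
    {M : Matrix (Fin 3) (Fin 3) F} (hM : M * M = 1) :
    ∃ r : ℕ, r ≤ 3 ∧ M.trace = 2 * r - 3 := by
  set P : Matrix (Fin 3) (Fin 3) F := (2 : F)⁻¹ • (1 + M) with hP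
  have hsq : (1 + M) * (1 + M) = (2 : F) • (1 + M) := by
    have e : (1 + M) * (1 + M) = 1 + M + M + M * M := by noncomm_ring
    rw [e, hM, two_smul]; abel
  have hPP : P * P = P := by
    rw [hP, Matrix.smul_mul, Matrix.mul_smul, smul_smul, hsq, smul_smul]
    congr 1
    field_simp
  set f := Matrix.toLin' P with hf
  have hidem : IsIdempotentElem f := by
    change f * f = f
    rw [hf, Module.End.mul_eq_comp, ← Matrix.toLin'_mul, hPP]
  have htr := (LinearMap.IsIdempotentElem.isProj_range f hidem).trace
  rw [hf, Matrix.trace_toLin'_eq] at htr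
  refine ⟨Module.finrank F (LinearMap.range f), ?_, ?_⟩
  · simpa using Submodule.finrank_le (LinearMap.range f)
  · have hPt : P.trace = (2 : F)⁻¹ * (3 + M.trace) := by
      rw [hP, Matrix.trace_smul, Matrix.trace_add, Matrix.trace_one, Fintype.card_fin, smul_eq_mul]
      norm_num
    rw [hPt] at htr
    field_simp at htr
    linear_combination htr

/-- **The conclusion of `AdjointSeedFromDuality` forces H3 verbatim (odd `p`).**  If `p ≠ 2` and
`ρ : Γ_ℚ →ₜ* GL₃(ℚ̄_p)` admits an odd `ρ₀` and `η` with `‖tr ρ(σ) − η(σ)(tr ρ₀(σ)²/det ρ₀(σ) − 1)‖ < 1`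
for all `σ`, then every complex conjugation `c` has `tr ρ(c) = 1 ∨ tr ρ(c) = −1` (exact equality in
`ℚ̄_p`): by `forces_parity` the residue of `tr ρ(c)` is `±1`, by `trace_involution_fin_three`
`tr ρ(c) ∈ {−3, −1, 1, 3}`, and `‖2‖ = ‖4‖ = 1` exclude `±3`. [folklore] -/
theorem forces_parity_exact {p : ℕ} [Fact p.Prime] (hp2 : p ≠ 2)
    {ρ : FramedGaloisRep ℚ (PadicAlgCl p) 3}
    (h : ∃ (ρ₀ : FramedGaloisRep ℚ (PadicAlgCl p) 2) (η : FramedGaloisRep ℚ (PadicAlgCl p) 1),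
      ρ₀.IsOdd ∧ ∀ σ, ‖(ρ σ).val.trace -
        (η σ).val 0 0 * ((ρ₀ σ).val.trace ^ 2 * ((ρ₀ σ).val.det)⁻¹ - 1)‖ < 1)
    {φ : ℚ →+* ℝ} {c : Field.absoluteGaloisGroup ℚ} (hc : IsComplexConjugation φ c) :
    (ρ c).val.trace = 1 ∨ (ρ c).val.trace = -1 := by
  have hpar := forces_parity h hc
  have hc2 : c * c = 1 := by rw [← sq]; exact hc.sq_eq_one
  have hM : (ρ c).val * (ρ c).val = 1 := by
    rw [← Units.val_mul, ← map_mul, hc2, map_one, Units.val_one]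
  have hp2' : p.Coprime 2 := (Nat.coprime_primes Fact.out Nat.prime_two).mpr hp2
  have hp4 : p.Coprime 4 := by simpa using Nat.Coprime.mul_right hp2' hp2'
  have n2 : ‖(2 : PadicAlgCl p)‖ = 1 := by exact_mod_cast norm_natCast_eq_one hp2'
  have n4 : ‖(4 : PadicAlgCl p)‖ = 1 := by exact_mod_cast norm_natCast_eq_one hp4
  obtain ⟨r, hr, htr⟩ := trace_involution_fin_three hM
  rw [htr] at hpar ⊢
  interval_cases r
  · exfalso; norm_num at hpar; rw [n4, n2] at hpar; simp at hpar
  · right; norm_num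
  · left; norm_num
  · exfalso; norm_num at hpar; rw [n2, n4] at hpar; simp at hpar

end Summit.Langlands.Langlands.Theorems.AdjointSeedFromDuality.Negative
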